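import Literature.NumberTheory.Automorphic.JacquetShalikaSchurSelfSum
import Literature.NumberTheory.Automorphic.PairLFunctionBaseChangeProofs
import HarnessLib

/-!
# `summable_normSq_trace_satakePow` over an arbitrary exceptional set: the two inputs, in the
currency of the unramified torus sums

Topic `NumberTheory/Automorphic`; namespace `Literature.NumberTheory.Automorphic`. Proof file
(theorems only: no definition, no named fact, no instance) for the named fact
`summable_normSq_trace_satakePow` of `AutomorphicLFunctionProofs` — Jacquet–Shalika, *On Euler
products and the classification of automorphic representations I*, Amer. J. Math. **103** (1981),
proof of Thm. (5.3), (5.3.3)–(5.3.4) p. 556: for a cuspidal `Π` on `GL_n(𝔸_K)` with Hecke–Satake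
parameters `α v` off a set `S` of finite places, `∑_{v ∉ S} ∑_{k ≥ 1} |tr A_v^k|² / (k q_v^{kσ}) < ∞`
for every real `σ > 1` — which the tree states for an **arbitrary** `S`, whereas the source (and the
junction **(J)** = `summable_normSq_trace_largeFinset` of `JacquetShalikaLargeFinset`, the common
target of the real-point Rankin–Selberg / mean-square programme of the topic) has `S` finite and
*large*. The difference is exactly the local bound (5.1.3) at the finitely many places of `S₀` at
which `Π` is unramified: for a single unramified place `v`, the convergence of
`∑_k |tr A_v^k|² / (k q_v^{kσ})` for all `σ > 1` *is* `|μ_{j,v}| ≤ q_v^{1/2}`. This file records the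
resulting bookkeeping, so that the fact comes to rest on statements in the one currency the global
theory produces at a real point `σ > 1` — the unramified torus sums
`T_v(t) = ∑_N (∑_{λ antitone, |λ| = N} |s_λ(x_v)|²) t^N ∈ [0, ∞]` (`schurSelfSum` of
`Literature.RingTheory.SymmetricFunctions.ShintaniSelfSum`, `x_v` an enumeration of `α v`):

* `summable_normSq_trace_satakePow_of_largeFinset_of_sqrt`,
  `summable_normSq_trace_satakePow_iff_largeFinset_and_sqrt` — **the fact is equivalent to
  (J) ∧ (5.1.3)** (`summable_normSq_trace_largeFinset ∧ norm_satakeParameter_le_sqrt`): given (J)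
  with its finite `S₀` and a Satake family `β` of `Π` off the finite set `R` of ramified places
  (Flath, discharged: `CuspidalAutomorphicRepGL.exists_finset_isSatakeFamilyOf`), (J) applies off
  `S₀ ∪ R`, and `summable_normSq_trace_satakePow_of_sqrt_of_one_family`
  (`PairLFunctionBaseChangeProofs`) covers the unramified places inside `S₀ ∪ R` by (5.1.3); the
  converse implications are already in the tree.
* `norm_satakeParameter_le_sqrt_iff_schurSelfSum_ne_top` — **(5.1.3) is equivalent to the
  pointwise finiteness of the torus sums**: `T_v(q_v^{-σ}) < ∞` for every Satake family `α` of `Π`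
  off any `S`, every `v ∉ S`, every enumeration of `α v` and every `σ > 1`. (`⇐`: finiteness of the
  self Cauchy sum forces `|x_i| |x_j| q_v^{-σ} < 1`, `norm_mul_norm_mul_lt_one_of_schurSelfSum_ne_top`,
  and `σ → 1⁺`; `⇒`: `|x_i| |x_j| q_v^{-σ} ≤ q_v^{1-σ} < 1` and `schurSelfSum_eq_ofReal_exp`.)
* `summable_normSq_trace_satakePow_iff_schurSelfSum_prod_bounded_and_ne_top` — hence **the fact is
  equivalent to `JacquetShalika1981_schurSelfSum_prod_bounded` (bounded partial products off large
  finite sets, `JacquetShalikaSchurSelfSum`) together with the pointwise finiteness**.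
* `summable_normSq_trace_satakePow_iff_schurSelfSum_prod_le` — and to the single statement:
  *for every Satake family `α` of `Π` off an arbitrary `S` and every `σ > 1`, the finite partial
  products of `v ↦ T_v(q_v^{-σ})` over `v ∉ S` are bounded in `[0, ∞]`*
  (`summable_normSq_trace_of_schurSelfSum_prod_le` of `JacquetShalikaSchurSelfSum` is already stated
  for arbitrary `S`; the converse is (5.1.3) plus Tonelli, as in
  `JacquetShalika1981_schurSelfSum_prod_bounded_of_largeFinset`).
* `schurSelfSum_prod_le_of_finite_bad` — the **combination lemma** by which the last statement is
  reached in practice: a bound `C` for the partial products over the places `v ∉ S` outside a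
  finite "bad" set `B`, together with the finiteness of `T_v(q_v^{-σ})` at each `v ∈ B`, `v ∉ S`,
  bounds all partial products over `v ∉ S` by `C · ∏_{v ∈ B} T_v(q_v^{-σ}) < ∞` (each `T_v ≥ 1`).

## What the global theory has to deliver for `summable_normSq_trace_satakePow_holds`

By the last two items: for each cuspidal `Π`, (a) **uniformly**, for one level `𝔫` and one
non-zero spherical vector, a bound on the partial products of `T_v(q_v^{-σ})` over the places `v`
outside a finite bad set `B ⊇ {v ∣ 𝔫}` (this is (J), the target shared with
`StandardLFunctionData.multipliable_L`); and (b) **pointwise**, at each of the finitely many places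
`v ∈ B` at which `Π` is nevertheless unramified, the finiteness of `T_v(q_v^{-σ})` for all `σ > 1` —
the same unfolding run once more at a level `𝔫_v` prime to `v` (`IsUnramifiedAt`), with auxiliary
data (additive character, idele class representatives) chosen unramified at `v`; equivalently (b) is
the local bound (5.1.3) `norm_satakeParameter_le_sqrt`, whose printed proof (Cor. (2.5) of the
source, the classification of generic unitary unramified representations) is the alternative.
Neither (a) nor (b) is proved here.

## References

* H. Jacquet, J. A. Shalika, *On Euler products and the classification of automorphic
  representations I*, Amer. J. Math. 103 (1981), 499–558: (5.1) and (5.1.3) p. 554; Thm. (5.3)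
  p. 555, proof pp. 555–557, (5.3.3)–(5.3.4) p. 556; Cor. (2.5) p. 515 [JacquetShalikaAJM1981].
* J. W. Cogdell, *Analytic theory of L-functions for GL_n*, in: J. Bernstein, S. Gelbart (eds.),
  *An Introduction to the Langlands Program*, Birkhäuser (2004), §2.3, §3 [CogdellAnalyticTheory2004].
* I. G. Macdonald, *Symmetric Functions and Hall Polynomials*, 2nd ed. (1995), Ch. I (4.3)
  [Macdonald1995].
-/

noncomputable section

open scoped MatrixGroups ComplexConjugate ENNReal
open NumberField IsDedekindDomain MeasureTheory Complex Filter Topology Finset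
open Literature.RingTheory.SymmetricFunctions.SymmPoly

namespace Literature.NumberTheory.Automorphic

/-! ### Torus sums: two elementary lemmas -/

section Torus

variable {K : Type} [Field K] [NumberField K]

/-- Every Schur self sum is `≥ 1` (its term at `N = 0` is `|s_0|² t⁰ = 1`). [folklore] -/
theorem one_le_schurSelfSum {m : ℕ} (x : Fin m → ℂ) (t : ℝ) : 1 ≤ schurSelfSum x t := by
  rw [schurSelfSum, shintaniSelfSum]
  refine le_trans (le_of_eq ?_) (ENNReal.le_tsum 0)
  rw [piAntidiag_zero, sum_singleton, schurTrunc_zero, norm_one, one_pow, pow_zero, mul_one,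
    ENNReal.ofReal_one]

/-- **Combination lemma.** Let `T : ι → [0, ∞]` with `T i ≥ 1` for all `i`, and `B` a finite set of
indices. If the partial products of `T` over finite sets disjoint from `B` are bounded by `C`, then
every partial product is bounded by `C · ∏_{i ∈ B} T i` (split `F = (F \ B) ∪ (F ∩ B)` and enlarge
`F ∩ B` to `B`, using `T ≥ 1`). [folklore] -/
theorem prod_le_mul_prod_of_one_le {ι : Type*} [DecidableEq ι] {T : ι → ℝ≥0∞} (hT : ∀ i, 1 ≤ T i)
    (B : Finset ι) {C : ℝ≥0∞} (hC : ∀ F : Finset ι, Disjoint F B → ∏ i ∈ F, T i ≤ C)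
    (F : Finset ι) : ∏ i ∈ F, T i ≤ C * ∏ i ∈ B, T i := by
  rw [← Finset.sdiff_union_inter F B, Finset.prod_union (Finset.disjoint_sdiff_inter F B)]
  refine mul_le_mul' (hC _ Finset.sdiff_disjoint) ?_
  exact Finset.prod_le_prod_of_subset_of_one_le' Finset.inter_subset_right fun i _ _ => hT i

/-- **Bounded partial products off a finite bad set, plus pointwise finiteness on it, bound all
partial products.** For torus sums `v ↦ T_v = schurSelfSum (x v) (q_v^{-σ})` indexed by the places
`v ∉ S`: if the partial products over finite sets of places avoiding the finite set `B` are `≤ C < ∞`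
and `T_v < ∞` for `v ∈ B`, then all partial products are `≤ C ∏_{v ∈ B, v ∉ S} T_v < ∞`. [folklore] -/
theorem schurSelfSum_prod_le_of_finite_bad {S : Set (HeightOneSpectrum (𝓞 K))} {m : ℕ}
    (x : {v : HeightOneSpectrum (𝓞 K) // v ∉ S} → Fin m → ℂ) (σ : ℝ)
    (B : Finset (HeightOneSpectrum (𝓞 K))) {C : ℝ≥0∞} (hC : C ≠ ⊤)
    (hle : ∀ F : Finset {v : HeightOneSpectrum (𝓞 K) // v ∉ S}, (∀ v ∈ F, v.1 ∉ B) →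
      ∏ v ∈ F, schurSelfSum (x v) ((v.1.residueCard : ℝ) ^ (-σ)) ≤ C)
    (hfin : ∀ v : {v : HeightOneSpectrum (𝓞 K) // v ∉ S}, v.1 ∈ B →
      schurSelfSum (x v) ((v.1.residueCard : ℝ) ^ (-σ)) ≠ ⊤) :
    ∃ C' : ℝ≥0∞, C' ≠ ⊤ ∧ ∀ F : Finset {v : HeightOneSpectrum (𝓞 K) // v ∉ S},
      ∏ v ∈ F, schurSelfSum (x v) ((v.1.residueCard : ℝ) ^ (-σ)) ≤ C' := by
  classical
  -- the bad places among the indices `v ∉ S`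
  set B' : Finset {v : HeightOneSpectrum (𝓞 K) // v ∉ S} :=
    (B.subtype fun v => v ∉ S) with hB'
  have hmemB' : ∀ v : {v : HeightOneSpectrum (𝓞 K) // v ∉ S}, v ∈ B' ↔ v.1 ∈ B := fun v => by
    rw [hB', Finset.mem_subtype]
  refine ⟨C * ∏ v ∈ B', schurSelfSum (x v) ((v.1.residueCard : ℝ) ^ (-σ)),
    ENNReal.mul_ne_top hC (ENNReal.prod_ne_top fun v hv => hfin v ((hmemB' v).1 hv)), fun F => ?_⟩
  refine prod_le_mul_prod_of_one_le (fun v => one_le_schurSelfSum (x v) _) B' (fun F' hF' => ?_) F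
  exact hle F' fun v hv hvB => Finset.disjoint_left.1 hF' hv ((hmemB' v).2 hvB)

end Torus

/-! ### The fact ⇔ (J) ∧ (5.1.3) -/

section Cuspidal

variable {n : ℕ} {K : Type} [Field K] [NumberField K]
  {μ : Measure (AdelicGroupData.gl n K).automorphicQuotient}
  [(AdelicGroupData.gl n K).IsAutomorphicMeasure μ]

/-- **`summable_normSq_trace_satakePow` from (J) and (5.1.3).** If the series (5.3.3) converges off
the large finite sets of places (`summable_normSq_trace_largeFinset`, Jacquet–Shalika (1981),
(5.3.3)–(5.3.4) as printed) and the Satake parameters of cusp forms satisfy `|a| ≤ q_v^{1/2}` at every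
unramified place (`norm_satakeParameter_le_sqrt`, loc. cit. (5.1.3)), then (5.3.3) converges off an
arbitrary `S` for every Satake family: with `S₀` from (J) and `β` a Satake family off the finite set
`R` of ramified places of `Π` (Flath, `CuspidalAutomorphicRepGL.exists_finset_isSatakeFamilyOf`), (J)
gives the series of `β` off `S₀ ∪ R`, and `summable_normSq_trace_satakePow_of_sqrt_of_one_family` does
the rest (uniqueness of Hecke–Satake parameters off `S ∪ S₀ ∪ R`, and a convergent geometric series at
each of the finitely many unramified places of `S₀ ∪ R` not in `S`, by (5.1.3)).
[cite: JacquetShalikaAJM1981, Thm. (5.3), proof, (5.1.3), (5.3.3)–(5.3.4)] -/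
theorem summable_normSq_trace_satakePow_of_largeFinset_of_sqrt
    (h₁ : norm_satakeParameter_le_sqrt (μ := μ)) (hJ : summable_normSq_trace_largeFinset (μ := μ)) :
    summable_normSq_trace_satakePow (μ := μ) := by
  classical
  refine summable_normSq_trace_satakePow_of_sqrt_of_one_family h₁ fun P => ?_
  obtain ⟨S₀, hS₀⟩ := hJ P
  obtain ⟨R, β, -, hβ⟩ := P.exists_finset_isSatakeFamilyOf
  have hβ' : IsSatakeFamilyOf P ↑(S₀ ∪ R) β :=
    hβ.mono (by rw [Finset.coe_union]; exact Set.subset_union_right)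
  exact ⟨S₀ ∪ R, β, hβ', fun σ hσ => hS₀ Finset.subset_union_left hβ' hσ⟩

/-- **`summable_normSq_trace_satakePow ⇔ (J) ∧ (5.1.3)`**: the arbitrary-`S` fact is the
conjunction of its printed large-finite-`S` form `summable_normSq_trace_largeFinset` and the local
bound `norm_satakeParameter_le_sqrt` (the forward implications are
`summable_normSq_trace_largeFinset_of_summable` and `norm_satakeParameter_le_sqrt_of_summable`).
[cite: JacquetShalikaAJM1981, Thm. (5.3), proof, (5.1.3), (5.3.3)–(5.3.4)] -/
theorem summable_normSq_trace_satakePow_iff_largeFinset_and_sqrt :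
    summable_normSq_trace_satakePow (μ := μ) ↔
      summable_normSq_trace_largeFinset (μ := μ) ∧ norm_satakeParameter_le_sqrt (μ := μ) :=
  ⟨fun h => ⟨summable_normSq_trace_largeFinset_of_summable h, norm_satakeParameter_le_sqrt_of_summable h⟩,
    fun h => summable_normSq_trace_satakePow_of_largeFinset_of_sqrt h.2 h.1⟩

/-! ### (5.1.3) ⇔ pointwise finiteness of the torus sums -/

/-- **(5.1.3) from the pointwise finiteness of the torus sums.** If for every Satake family `α` of a
cuspidal `Π` off a set `S`, every `v ∉ S`, every enumeration `x` of `α v` and every `σ > 1` the torus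
sum `T_v(q_v^{-σ}) = schurSelfSum x (q_v^{-σ})` is finite, then `|a| ≤ q_v^{1/2}` for all `a ∈ α v`:
finiteness of the self Cauchy sum forces `|x_i|² q_v^{-σ} < 1`
(`norm_mul_norm_mul_lt_one_of_schurSelfSum_ne_top`), i.e. `|a|² < q_v^{σ}` for every `σ > 1`, and
`σ → 1⁺`. [cite: JacquetShalikaAJM1981, (5.1.3)] -/
theorem norm_satakeParameter_le_sqrt_of_schurSelfSum_ne_top
    (h : ∀ (P : CuspidalAutomorphicRepGL n K μ) {S : Set (HeightOneSpectrum (𝓞 K))}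
      {α : SatakeFamily K}, IsSatakeFamilyOf P S α → ∀ {v : HeightOneSpectrum (𝓞 K)}, v ∉ S →
        ∀ x : Fin n → ℂ, (univ : Finset (Fin n)).val.map x = α v →
          ∀ ⦃σ : ℝ⦄, 1 < σ → schurSelfSum x ((v.residueCard : ℝ) ^ (-σ)) ≠ ⊤) :
    norm_satakeParameter_le_sqrt (μ := μ) := by
  intro P S α hα v hv a ha
  obtain ⟨x, hx⟩ := exists_univ_val_map_eq (hα.card_eq hv)
  have ha' : a ∈ (univ : Finset (Fin n)).val.map x := by rwa [hx]
  obtain ⟨i, -, rfl⟩ := Multiset.mem_map.1 ha'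
  have hq1 : (1 : ℝ) < v.residueCard := by exact_mod_cast v.one_lt_residueCard
  have hq0 : (0 : ℝ) < v.residueCard := zero_lt_one.trans hq1
  -- `|x i|² ≤ q^σ` for every `σ > 1`
  have hbound : ∀ σ : ℝ, 1 < σ → ‖x i‖ ^ 2 ≤ (v.residueCard : ℝ) ^ σ := by
    intro σ hσ
    have hlt := norm_mul_norm_mul_lt_one_of_schurSelfSum_ne_top x (Real.rpow_nonneg hq0.le _)
      (h P hα hv x hx hσ) i i
    rw [Real.rpow_neg hq0.le, mul_inv_lt_iff₀ (Real.rpow_pos_of_pos hq0 σ), one_mul] at hlt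
    rw [sq]
    exact hlt.le
  -- pass to the limit `σ → 1⁺`
  have hlim : Tendsto (fun σ : ℝ => (v.residueCard : ℝ) ^ σ) (𝓝[>] 1)
      (𝓝 ((v.residueCard : ℝ) ^ (1 : ℝ))) :=
    ((Real.continuousAt_const_rpow hq0.ne').tendsto).mono_left nhdsWithin_le_nhds
  have hle : ‖x i‖ ^ 2 ≤ (v.residueCard : ℝ) ^ (1 : ℝ) :=
    ge_of_tendsto hlim (eventually_nhdsWithin_of_forall fun σ hσ => hbound σ hσ)
  rw [Real.rpow_one] at hle
  calc ‖x i‖ = Real.sqrt (‖x i‖ ^ 2) := (Real.sqrt_sq (norm_nonneg _)).symm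
    _ ≤ Real.sqrt v.residueCard := Real.sqrt_le_sqrt hle

/-- **Pointwise finiteness of the torus sums from (5.1.3).** Conversely, if `|a| ≤ q_v^{1/2}` for
all `a ∈ α v` then `|x_i| |x_j| q_v^{-σ} ≤ q_v^{1-σ} < 1` for `σ > 1`, so
`T_v(q_v^{-σ}) = exp (∑_k |p_k(x)|² q_v^{-kσ}/k) < ∞` (`schurSelfSum_eq_ofReal_exp`, Cauchy's identity).
[cite: JacquetShalikaAJM1981, (5.1.3)] -/
theorem schurSelfSum_ne_top_of_norm_satakeParameter_le_sqrt
    (h₁ : norm_satakeParameter_le_sqrt (μ := μ)) (P : CuspidalAutomorphicRepGL n K μ)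
    {S : Set (HeightOneSpectrum (𝓞 K))} {α : SatakeFamily K} (hα : IsSatakeFamilyOf P S α)
    {v : HeightOneSpectrum (𝓞 K)} (hv : v ∉ S) (x : Fin n → ℂ)
    (hx : (univ : Finset (Fin n)).val.map x = α v) {σ : ℝ} (hσ : 1 < σ) :
    schurSelfSum x ((v.residueCard : ℝ) ^ (-σ)) ≠ ⊤ := by
  have hq1 : (1 : ℝ) < v.residueCard := by exact_mod_cast v.one_lt_residueCard
  have hq0 : (0 : ℝ) < v.residueCard := zero_lt_one.trans hq1
  have hsqrt : ∀ i, ‖x i‖ ≤ Real.sqrt v.residueCard := fun i =>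
    h₁ P hα hv (by rw [← hx]; exact Multiset.mem_map_of_mem _ (Finset.mem_univ_val i))
  have hsmall : ∀ i j, ‖x i‖ * ‖x j‖ * (v.residueCard : ℝ) ^ (-σ) < 1 := by
    intro i j
    calc ‖x i‖ * ‖x j‖ * (v.residueCard : ℝ) ^ (-σ)
          ≤ Real.sqrt v.residueCard * Real.sqrt v.residueCard * (v.residueCard : ℝ) ^ (-σ) :=
          mul_le_mul_of_nonneg_right (mul_le_mul (hsqrt i) (hsqrt j) (norm_nonneg _)
            (Real.sqrt_nonneg _)) (Real.rpow_nonneg hq0.le _)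
      _ = (v.residueCard : ℝ) ^ (1 - σ) := by
          rw [Real.mul_self_sqrt hq0.le, show (1 - σ : ℝ) = 1 + -σ by ring, Real.rpow_add hq0,
            Real.rpow_one]
      _ < 1 := Real.rpow_lt_one_of_one_lt_of_neg hq1 (by linarith)
  rw [schurSelfSum_eq_ofReal_exp x (Real.rpow_nonneg hq0.le _) hsmall]
  exact ENNReal.ofReal_ne_top

/-- **(5.1.3) ⇔ pointwise finiteness of the unramified torus sums at every `σ > 1`.**
[cite: JacquetShalikaAJM1981, (5.1.3)] -/
theorem norm_satakeParameter_le_sqrt_iff_schurSelfSum_ne_top :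
    norm_satakeParameter_le_sqrt (μ := μ) ↔
      ∀ (P : CuspidalAutomorphicRepGL n K μ) {S : Set (HeightOneSpectrum (𝓞 K))}
        {α : SatakeFamily K}, IsSatakeFamilyOf P S α → ∀ {v : HeightOneSpectrum (𝓞 K)}, v ∉ S →
          ∀ x : Fin n → ℂ, (univ : Finset (Fin n)).val.map x = α v →
            ∀ ⦃σ : ℝ⦄, 1 < σ → schurSelfSum x ((v.residueCard : ℝ) ^ (-σ)) ≠ ⊤ :=
  ⟨fun h₁ P _ _ hα _ hv x hx _ hσ => schurSelfSum_ne_top_of_norm_satakeParameter_le_sqrt h₁ P hα hv x hx hσ,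
    norm_satakeParameter_le_sqrt_of_schurSelfSum_ne_top⟩

/-! ### The fact in the currency of torus sums -/

/-- **`summable_normSq_trace_satakePow` from bounded torus-sum products off large finite sets plus
pointwise finiteness.** `JacquetShalika1981_schurSelfSum_prod_bounded` (`JacquetShalikaSchurSelfSum`)
gives (J) (`summable_normSq_trace_largeFinset_of_schurSelfSum_prod_bounded`), the pointwise finiteness
gives (5.1.3) (`norm_satakeParameter_le_sqrt_of_schurSelfSum_ne_top`), and
`summable_normSq_trace_satakePow_of_largeFinset_of_sqrt` combines them.
[cite: JacquetShalikaAJM1981, Thm. (5.3), proof, (5.1.3), (5.3.3)–(5.3.4)] -/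
theorem summable_normSq_trace_satakePow_of_schurSelfSum_prod_bounded_of_ne_top
    (hb : JacquetShalika1981_schurSelfSum_prod_bounded (μ := μ))
    (hp : ∀ (P : CuspidalAutomorphicRepGL n K μ) {S : Set (HeightOneSpectrum (𝓞 K))}
      {α : SatakeFamily K}, IsSatakeFamilyOf P S α → ∀ {v : HeightOneSpectrum (𝓞 K)}, v ∉ S →
        ∀ x : Fin n → ℂ, (univ : Finset (Fin n)).val.map x = α v →
          ∀ ⦃σ : ℝ⦄, 1 < σ → schurSelfSum x ((v.residueCard : ℝ) ^ (-σ)) ≠ ⊤) :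
    summable_normSq_trace_satakePow (μ := μ) :=
  summable_normSq_trace_satakePow_of_largeFinset_of_sqrt
    (norm_satakeParameter_le_sqrt_of_schurSelfSum_ne_top hp)
    (summable_normSq_trace_largeFinset_of_schurSelfSum_prod_bounded hb)

/-- **`summable_normSq_trace_satakePow ⇔` bounded torus-sum products off large finite sets `∧`
pointwise finiteness of the torus sums** (the converses being
`JacquetShalika1981_schurSelfSum_prod_bounded_of_largeFinset` and
`schurSelfSum_ne_top_of_norm_satakeParameter_le_sqrt`).
[cite: JacquetShalikaAJM1981, Thm. (5.3), proof, (5.1.3), (5.3.3)–(5.3.4)] -/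
theorem summable_normSq_trace_satakePow_iff_schurSelfSum_prod_bounded_and_ne_top :
    summable_normSq_trace_satakePow (μ := μ) ↔
      JacquetShalika1981_schurSelfSum_prod_bounded (μ := μ) ∧
        ∀ (P : CuspidalAutomorphicRepGL n K μ) {S : Set (HeightOneSpectrum (𝓞 K))}
          {α : SatakeFamily K}, IsSatakeFamilyOf P S α → ∀ {v : HeightOneSpectrum (𝓞 K)}, v ∉ S →
            ∀ x : Fin n → ℂ, (univ : Finset (Fin n)).val.map x = α v →
              ∀ ⦃σ : ℝ⦄, 1 < σ → schurSelfSum x ((v.residueCard : ℝ) ^ (-σ)) ≠ ⊤ := by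
  constructor
  · intro h
    exact ⟨JacquetShalika1981_schurSelfSum_prod_bounded_of_largeFinset
        (summable_normSq_trace_largeFinset_of_summable h),
      fun P _ _ hα _ hv x hx _ hσ => schurSelfSum_ne_top_of_norm_satakeParameter_le_sqrt
        (norm_satakeParameter_le_sqrt_of_summable h) P hα hv x hx hσ⟩
  · exact fun h => summable_normSq_trace_satakePow_of_schurSelfSum_prod_bounded_of_ne_top h.1 h.2

/-- **`summable_normSq_trace_satakePow` from bounded torus-sum products off an arbitrary `S`.** If for
every Satake family `α` of a cuspidal `Π` off an arbitrary set `S` of places, every enumeration `x` of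
it and every `σ > 1` the finite partial products of `v ↦ T_v(q_v^{-σ})` over `v ∉ S` are bounded in
`[0, ∞]`, then the fact holds — `summable_normSq_trace_of_schurSelfSum_prod_le` of
`JacquetShalikaSchurSelfSum`, which is stated for arbitrary `S`, after enumerating each `α v`
(`card (α v) = n`, `IsSatakeFamilyOf.card_eq`). [cite: JacquetShalikaAJM1981, Thm. (5.3), proof, (5.3.3)–(5.3.4)] -/
theorem summable_normSq_trace_satakePow_of_schurSelfSum_prod_le
    (h : ∀ (P : CuspidalAutomorphicRepGL n K μ) {S : Set (HeightOneSpectrum (𝓞 K))}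
      {α : SatakeFamily K}, IsSatakeFamilyOf P S α →
        ∀ (x : {v : HeightOneSpectrum (𝓞 K) // v ∉ S} → Fin n → ℂ),
          (∀ v, (univ : Finset (Fin n)).val.map (x v) = α v.1) → ∀ ⦃σ : ℝ⦄, 1 < σ →
            ∃ C : ℝ≥0∞, C ≠ ⊤ ∧ ∀ F : Finset {v : HeightOneSpectrum (𝓞 K) // v ∉ S},
              ∏ v ∈ F, schurSelfSum (x v) ((v.1.residueCard : ℝ) ^ (-σ)) ≤ C) :
    summable_normSq_trace_satakePow (μ := μ) := by
  intro P S α hα σ hσ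
  have hex : ∀ v : {v : HeightOneSpectrum (𝓞 K) // v ∉ S},
      ∃ x : Fin n → ℂ, (univ : Finset (Fin n)).val.map x = α v.1 :=
    fun v => exists_univ_val_map_eq (hα.card_eq v.2)
  choose x hx using hex
  obtain ⟨C, hC, hle⟩ := h P hα x hx hσ
  exact summable_normSq_trace_of_schurSelfSum_prod_le x hx hC hle

/-- **Bounded torus-sum products off an arbitrary `S` from `summable_normSq_trace_satakePow`** (the
converse): the fact gives (5.1.3) (`norm_satakeParameter_le_sqrt_of_summable`), so each
`T_v(q_v^{-σ}) = exp G_v` with `G_v = ∑_k |tr A_v^k|² q_v^{-kσ}/k` (`schurSelfSum_eq_ofReal_exp`), and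
`∏_{v ∈ F} T_v = exp ∑_{v ∈ F} G_v ≤ exp ∑_{v ∉ S} G_v < ∞` by the fact itself (Tonelli); the
argument of `JacquetShalika1981_schurSelfSum_prod_bounded_of_largeFinset` for an arbitrary `S`.
[folklore] -/
theorem schurSelfSum_prod_le_of_summable_normSq_trace_satakePow
    (h : summable_normSq_trace_satakePow (μ := μ)) (P : CuspidalAutomorphicRepGL n K μ)
    {S : Set (HeightOneSpectrum (𝓞 K))} {α : SatakeFamily K} (hα : IsSatakeFamilyOf P S α)
    (x : {v : HeightOneSpectrum (𝓞 K) // v ∉ S} → Fin n → ℂ)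
    (hx : ∀ v, (univ : Finset (Fin n)).val.map (x v) = α v.1) {σ : ℝ} (hσ : 1 < σ) :
    ∃ C : ℝ≥0∞, C ≠ ⊤ ∧ ∀ F : Finset {v : HeightOneSpectrum (𝓞 K) // v ∉ S},
      ∏ v ∈ F, schurSelfSum (x v) ((v.1.residueCard : ℝ) ^ (-σ)) ≤ C := by
  have hsum := h P hα hσ
  have h₁ := norm_satakeParameter_le_sqrt_of_summable h
  have ht0 : ∀ v : {v : HeightOneSpectrum (𝓞 K) // v ∉ S}, (0 : ℝ) ≤ (v.1.residueCard : ℝ) ^ (-σ) :=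
    fun v => Real.rpow_nonneg (Nat.cast_nonneg _) _
  have hsmall : ∀ v : {v : HeightOneSpectrum (𝓞 K) // v ∉ S}, ∀ i j,
      ‖x v i‖ * ‖x v j‖ * (v.1.residueCard : ℝ) ^ (-σ) < 1 := fun v i j =>
    norm_mul_norm_mul_lt_one_of_schurSelfSum_ne_top (x v) (ht0 v)
      (schurSelfSum_ne_top_of_norm_satakeParameter_le_sqrt h₁ P hα v.2 (x v) (hx v) hσ) i j
  -- the local series and their sums
  let g : ℕ × {v : HeightOneSpectrum (𝓞 K) // v ∉ S} → ℝ := fun kv =>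
    ‖∑ i, x kv.2 i ^ (kv.1 + 1)‖ ^ 2 * ((kv.2.1.residueCard : ℝ) ^ (-σ)) ^ (kv.1 + 1) / (kv.1 + 1)
  have hg0 : ∀ kv, 0 ≤ g kv := fun kv => by positivity
  have hg : Summable g := by
    refine hsum.congr fun kv => ?_
    obtain ⟨k, v⟩ := kv
    have hq0 : (0 : ℝ) < v.1.residueCard := by
      exact_mod_cast (zero_lt_one.trans v.1.one_lt_residueCard)
    show _ = g (k, v)
    simp only [g, multiset_powerSum_eq_sum (hx v)]
    exact (mul_rpow_neg_pow_div_eq hq0 σ _ k).symm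
  have hprod : Summable fun p : {v : HeightOneSpectrum (𝓞 K) // v ∉ S} × ℕ => g (p.2, p.1) :=
    hg.prod_symm
  obtain ⟨-, hGsum⟩ := (summable_prod_of_nonneg fun p => hg0 (p.2, p.1)).mp hprod
  have hG0 : ∀ v : {v : HeightOneSpectrum (𝓞 K) // v ∉ S}, 0 ≤ ∑' k : ℕ, g (k, v) :=
    fun v => tsum_nonneg fun k => hg0 (k, v)
  refine ⟨ENNReal.ofReal (Real.exp (∑' v, ∑' k : ℕ, g (k, v))), ENNReal.ofReal_ne_top, fun F => ?_⟩
  have hTv : ∀ v : {v : HeightOneSpectrum (𝓞 K) // v ∉ S},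
      schurSelfSum (x v) ((v.1.residueCard : ℝ) ^ (-σ)) =
        ENNReal.ofReal (Real.exp (∑' k : ℕ, g (k, v))) :=
    fun v => schurSelfSum_eq_ofReal_exp (x v) (ht0 v) (hsmall v)
  calc ∏ v ∈ F, schurSelfSum (x v) ((v.1.residueCard : ℝ) ^ (-σ))
        = ∏ v ∈ F, ENNReal.ofReal (Real.exp (∑' k : ℕ, g (k, v))) :=
        Finset.prod_congr rfl fun v _ => hTv v
    _ = ENNReal.ofReal (Real.exp (∑ v ∈ F, ∑' k : ℕ, g (k, v))) := by
        rw [Real.exp_sum, ENNReal.ofReal_prod_of_nonneg fun v _ => (Real.exp_pos _).le]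
    _ ≤ ENNReal.ofReal (Real.exp (∑' v, ∑' k : ℕ, g (k, v))) :=
        ENNReal.ofReal_le_ofReal (Real.exp_le_exp.mpr (hGsum.sum_le_tsum F fun v _ => hG0 v))

/-- **`summable_normSq_trace_satakePow ⇔` the finite partial products of the unramified torus sums of
every Satake family off an arbitrary `S` are bounded at every `σ > 1`.** This single statement in
`[0, ∞]` is what the global theory at a real point has to deliver for the fact (uniformly off a finite
bad set of places, and pointwise on it: `schurSelfSum_prod_le_of_finite_bad`).
[cite: JacquetShalikaAJM1981, Thm. (5.3), proof, (5.1.3), (5.3.3)–(5.3.4)] -/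
theorem summable_normSq_trace_satakePow_iff_schurSelfSum_prod_le :
    summable_normSq_trace_satakePow (μ := μ) ↔
      ∀ (P : CuspidalAutomorphicRepGL n K μ) {S : Set (HeightOneSpectrum (𝓞 K))}
        {α : SatakeFamily K}, IsSatakeFamilyOf P S α →
          ∀ (x : {v : HeightOneSpectrum (𝓞 K) // v ∉ S} → Fin n → ℂ),
            (∀ v, (univ : Finset (Fin n)).val.map (x v) = α v.1) → ∀ ⦃σ : ℝ⦄, 1 < σ →
              ∃ C : ℝ≥0∞, C ≠ ⊤ ∧ ∀ F : Finset {v : HeightOneSpectrum (𝓞 K) // v ∉ S},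
                ∏ v ∈ F, schurSelfSum (x v) ((v.1.residueCard : ℝ) ^ (-σ)) ≤ C :=
  ⟨fun h P _ _ hα x hx _ hσ => schurSelfSum_prod_le_of_summable_normSq_trace_satakePow h P hα x hx hσ,
    summable_normSq_trace_satakePow_of_schurSelfSum_prod_le⟩

/-- **The practical form: a uniform bound off a finite bad set of places, plus pointwise finiteness on
it.** If for every Satake family `α` of a cuspidal `Π` off `S`, every enumeration `x` and every `σ > 1`
there are a finite set `B` of places and `C < ∞` bounding the partial products of `T_v(q_v^{-σ})` over
finite sets of places `v ∉ S` avoiding `B`, while `T_v(q_v^{-σ}) < ∞` at each `v ∈ B`, `v ∉ S`, then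
`summable_normSq_trace_satakePow` holds (`schurSelfSum_prod_le_of_finite_bad` and
`summable_normSq_trace_satakePow_of_schurSelfSum_prod_le`).
[cite: JacquetShalikaAJM1981, Thm. (5.3), proof, (5.1.3), (5.3.3)–(5.3.4)] -/
theorem summable_normSq_trace_satakePow_of_finite_bad
    (h : ∀ (P : CuspidalAutomorphicRepGL n K μ) {S : Set (HeightOneSpectrum (𝓞 K))}
      {α : SatakeFamily K}, IsSatakeFamilyOf P S α →
        ∀ (x : {v : HeightOneSpectrum (𝓞 K) // v ∉ S} → Fin n → ℂ),
          (∀ v, (univ : Finset (Fin n)).val.map (x v) = α v.1) → ∀ ⦃σ : ℝ⦄, 1 < σ →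
            ∃ (B : Finset (HeightOneSpectrum (𝓞 K))) (C : ℝ≥0∞), C ≠ ⊤ ∧
              (∀ F : Finset {v : HeightOneSpectrum (𝓞 K) // v ∉ S}, (∀ v ∈ F, v.1 ∉ B) →
                ∏ v ∈ F, schurSelfSum (x v) ((v.1.residueCard : ℝ) ^ (-σ)) ≤ C) ∧
              ∀ v : {v : HeightOneSpectrum (𝓞 K) // v ∉ S}, v.1 ∈ B →
                schurSelfSum (x v) ((v.1.residueCard : ℝ) ^ (-σ)) ≠ ⊤) :
    summable_normSq_trace_satakePow (μ := μ) := by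
  refine summable_normSq_trace_satakePow_of_schurSelfSum_prod_le fun P S α hα x hx σ hσ => ?_
  obtain ⟨B, C, hC, hle, hfin⟩ := h P hα x hx hσ
  exact schurSelfSum_prod_le_of_finite_bad x σ B hC hle hfin

end Cuspidal

end Literature.NumberTheory.Automorphic
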